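import Literature.NumberTheory.EllipticCurves.H1CorestrictionIndexTwo
import Literature.NumberTheory.EllipticCurves.H1UnramifiedFinite
import Literature.NumberTheory.GaloisRepresentations.ContinuousH1OrderTwo
import HarnessLib

/-!
# Route `ByReductionTypeAtTwo`, crux `RankOneAtTwoOffBigImageOddLocal` (stmt-BirchSwinnertonDyer-23716), line
# `refined_kolyvagin_tamagawa_shift_at_two`, stub `stub_sigmaShiftPosDisc`: A CORESTRICTED CLASS DIES ON EVERY
# INVOLUTION OUTSIDE THE SUBGROUP — the archimedean criterion for `ℚ`-descended classes (generic, PROVED)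

Helper (lead `prover-cruxlead-stmt-BirchSwinnertonDyer-23716-g5`; `--supports` the crux, closes nothing).

WHY.  The lead's stub `stub_sigmaShiftPosDisc` (McCallum's structure theorem at `2` on {full `2`-adic image,
`Δ > 0`}, `M_∞ = σ ≥ 1`) is to be run in the sibling route's eigen/`ℚ` architecture (pair descent for `E` and
`E^{(d_K)}` over `ℚ`, `…GenusKolyvaginAtTwoVisiblePairAtTwoDefs.Input`), whose inputs `loc_c₁_inf` / `loc_c₂_inf`
(McCallum's Lemma 4.3 over `ℚ` AT THE REAL PLACE for the `ℚ`-descended Kolyvagin classes) are vacuous on `Δ < 0`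
(`…ArchimedeanSelmerLevel`: `H¹(ℝ, E) = 0`) but NOT on `Δ > 0` (`H¹(ℝ, E) ≅ π₀(E(ℝ))^∨ = ℤ/2`) — the located
non-port of the lead g4 memo `Cruxes/…/SigmaShiftPosDiscArchimedean.md`.  This file proves the one structural
criterion that holds on EITHER sign of `Δ`: a class over `ℚ` that is a CORESTRICTION from the imaginary
quadratic field `K` vanishes identically at the real place, because the decomposition group `{1, c_∞}` meets
`Γ_K` trivially (double-coset formula with a single double coset: `res_{D} ∘ cor_{Γ_K}^{Γ_ℚ} =
cor_{1}^{D} ∘ res = 0`).  Since `res ∘ cor = 1 + τ_*` and `res : H¹(ℚ, E[2^M]) → H¹(K, E[2^M])^{τ}` is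
bijective when `E(K)[2] = 0` (the habitat), the `ℚ`-descended class `d(n)` of a Kolyvagin class `c(n)` is a
corestriction iff `c(n)` is a NORM `(1 + τ_*) c′`; so the archimedean obstruction of `d(n)` factors through the
class of `c(n)` in `Ĥ⁰(Gal(K/ℚ), H¹(K, E[2^M]))` — a sharper target than «the attached point lies on the
identity real component».

WHAT (generic continuous group cohomology in the tree's model — `discreteH1`, `subgroupH1`, the index-`2`
transfer `corFun` / `corCocycle` / `corH1` of `Literature/…/H1CorestrictionIndexTwo`, local conditions `resKer` /
`subgroupResKer`; `G` a topological group, `N` an open normal subgroup of index `2` with coset representative `c`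
(`Xor (b c⁻¹ ∈ N) (b ∈ N)`), `M` a discrete `G`-module with continuous orbit maps):
* §1 `corFun_apply_involution` — THE IDENTITY: for `τ ∉ N` with `τ² = 1` and every crossed homomorphism `f` on
  `N`, the transfer takes the value `F(τ) = m − τ • m` with `m = f(τ c)` (`τ c ∈ N`); i.e. `F|_{⟨τ⟩}` is the
  coboundary of `−m` (any coset representative `c`; for `c = τ` it is `F(τ) = f(1) = 0`).
* §2 `corH1_mem_resKer_of_involution` — for every compatible pair `(φ : H → G, ψ : M → M')` whose image lies in
  `{1, τ}`: `cor(y) ∈ resKer φ ψ` for all `y ∈ H¹(N, M)`; `corH1_mem_subgroupResKer_of_involution` — the same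
  for a subgroup `D ≤ G` with `D ⊆ {1, τ}`; `corH1_mem_resKer_of_natCard_le_two` — for `H` of order `≤ 2` whose
  image meets `N` trivially (the shape of a real place of `ℚ` against an imaginary quadratic `K`:
  `#Γ_ℝ = 2`, complex conjugation `∉ Γ_K`).
* §3 `mem_range_corH1_iff_exists_norm` — on the habitat shape (`res` injective): `x ∈ im(cor) ↔ res x` is a
  norm `y + c_* y`; hence `resKer`-membership at an involution for every `x` whose restriction is a norm
  (`mem_resKer_of_resSubgroupH1_eq_norm`).

Left for the sequel (number-field plumbing, not cohomology): for `K/ℚ` imaginary quadratic and the real place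
`w` of `ℚ`, the image of `Γ_{ℚ_w} → Γ_ℚ` meets `galRange K` trivially (a real place does not split in `K`),
which turns §2 into `cor(y) ∈ selmerLocalKer W ℚ_w n` verbatim.  Everything here is PROVED (no `sorry`, no new
definition, no named fact, standard axioms).  BSD is not proved by any of this; the stub is not proved by this.

References: [SerreGaloisCohomology1997] I §2.4 (res, cor), I §5.8; [NeukirchSchmidtWingberg2008] I §5 (cor on
cochains; double coset formula Prop. 1.5.6); [McCallumLMS1991] §4 Lemma 4.3 (the local conditions of the
Kolyvagin classes); [GrossLMS1991] §6 proof of Prop. 6.2 (1) (the archimedean place); [MilneADT2006] I Rem. 3.7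
(`H¹(ℝ, A) ≅ π₀(A(ℝ))^∨`).
-/

set_option autoImplicit false
set_option linter.dupNamespace false -- tree convention: `Summit.BirchSwinnertonDyer.BirchSwinnertonDyer.Theorems` (summit = sub-problem)

noncomputable section

namespace Summit.BirchSwinnertonDyer.BirchSwinnertonDyer.Theorems.OffBigImageOddLocalAtTwo.ArchCorestriction

open Literature.NumberTheory.EllipticCurves Literature.NumberTheory.GaloisRepresentations

universe u

variable {G : Type u} [Group G] [TopologicalSpace G] [IsTopologicalGroup G]
variable {N : Subgroup G} [N.Normal] {c : G}
variable {M : Type u} [AddCommGroup M] [DistribMulAction G M] [TopologicalSpace M] [DiscreteTopology M]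

/-! ## §1 The transfer at an involution outside `N` -/

omit [TopologicalSpace G] [IsTopologicalGroup G] [N.Normal] in
/-- For `τ ∉ N` (so `τ c⁻¹ ∈ N`) one has `τ c = (τ c⁻¹) c² ∈ N`. [folklore] -/
theorem mul_mem_of_not_mem (hc : ∀ b : G, Xor (b * c⁻¹ ∈ N) (b ∈ N)) {τ : G} (hτN : τ ∉ N) :
    τ * c ∈ N := by
  have h : τ * c = τ * c⁻¹ * (c * c) := by group
  rw [h]
  exact N.mul_mem (mul_inv_mem_of_not_mem hc hτN) (mul_self_mem_of_xor hc)

/-- **The transfer at an involution outside `N` is an explicit coboundary.**  For the index-`2` transfer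
`F = corFun hc f` of a continuous crossed homomorphism `f` on `N` (coset representative `c`) and any `τ ∉ N` with
`τ² = 1`: `F(τ) = m − τ • m`, `m = f(τ c)`.  (Write `τ = n₀ c`; then `c⁻¹ n₀ c = (c²)⁻¹ n₀⁻¹`, `c (c²)⁻¹ n₀⁻¹ = τ`,
`τ n₀ = c⁻¹`, and the cocycle identities give `f(n₀) + c • f(c⁻¹ n₀ c) + n₀ • f(c²) = (1 − τ) • f(n₀ c²)`.)
[cite: NeukirchSchmidtWingberg2008, I §5 (corestriction on cochains; double coset formula)] -/
theorem corFun_apply_involution (hc : ∀ b : G, Xor (b * c⁻¹ ∈ N) (b ∈ N))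
    (f : contOneCocycles (discreteTopRep N M)) {τ : G} (hτN : τ ∉ N) (hτ : τ * τ = 1) :
    corFun hc f τ = f.1 ⟨τ * c, mul_mem_of_not_mem hc hτN⟩ - τ • f.1 ⟨τ * c, mul_mem_of_not_mem hc hτN⟩ := by
  set n₀ : N := ⟨τ * c⁻¹, mul_inv_mem_of_not_mem hc hτN⟩ with hn₀
  have hτinv : τ⁻¹ = τ := inv_eq_of_mul_eq_one_right hτ
  have hτeq : τ = (n₀ : G) * c := by simp [n₀]
  have h1 : corFun hc f τ = (symCocycle c f).1 n₀ + (n₀ : G) • f.1 (cSq hc) := by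
    conv_lhs => rw [hτeq]
    exact corFun_coe_mul hc f n₀
  -- the conjugate `c⁻¹ n₀ c` and the element `τ c` inside `N`
  have hconj : subgroupConj N c n₀ = (cSq hc)⁻¹ * n₀⁻¹ := by
    apply Subtype.ext
    simp only [subgroupConj_apply_coe, Subgroup.coe_mul, Subgroup.coe_inv, cSq_coe, n₀, mul_inv_rev, inv_inv]
    -- `c⁻¹ (τ c⁻¹) c = c⁻¹ c⁻¹ (c τ⁻¹)`; with `τ⁻¹ = τ`
    rw [hτinv]
    group
  have hprod : (⟨τ * c, mul_mem_of_not_mem hc hτN⟩ : N) = n₀ * cSq hc := by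
    apply Subtype.ext
    simp only [Subgroup.coe_mul, cSq_coe, n₀]
    group
  -- three group identities in `G`
  have e1 : c * ((c * c)⁻¹ * (τ * c⁻¹)⁻¹) = τ := by
    rw [mul_inv_rev, mul_inv_rev, inv_inv, hτinv]; group
  have e2 : c * (c * c)⁻¹ = c⁻¹ := by group
  have e3 : τ * (τ * c⁻¹) = c⁻¹ := by rw [← mul_assoc, hτ, one_mul]
  rw [h1, symCocycle_apply, hconj, hprod, cocycle_mul, cocycle_mul, cocycle_inv, cocycle_inv]
  simp only [Subgroup.coe_inv, cSq_coe, smul_add, smul_neg, smul_smul, n₀]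
  rw [e1, e2, e3]
  abel

/-- The transfer vanishes at `1`. [folklore] -/
theorem corFun_apply_one (hc : ∀ b : G, Xor (b * c⁻¹ ∈ N) (b ∈ N))
    (f : contOneCocycles (discreteTopRep N M)) : corFun hc f 1 = 0 := by
  have h := corFun_coe hc f 1
  rw [Subgroup.coe_one] at h
  rw [h, symCocycle_apply, map_one (subgroupConj N c), cocycle_one N f, smul_zero, add_zero]

/-! ## §2 Corestricted classes die on `{1, τ}` -/

section ResKer

variable {H : Type u} [Group H] [TopologicalSpace H] [IsTopologicalGroup H]
variable {M' : Type u} [AddCommGroup M'] [DistribMulAction H M'] [TopologicalSpace M'] [DiscreteTopology M']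

/-- **A corestricted class dies along every compatible pair whose image is `{1, τ}`, `τ ∉ N` an involution.**
For `φ : H → G` continuous with `φ(H) ⊆ {1, τ}`, `ψ : M → M'` equivariant along `φ`, and every `y ∈ H¹(N, M)`:
`cor(y) ∈ resKer φ ψ` (the pulled-back cocycle `ψ ∘ F ∘ φ` is the coboundary of `ψ(−m)`, §1).  The archimedean
instance: `G = Γ_ℚ`, `N = Γ_K` for `K` imaginary quadratic, `H = Γ_ℝ = {1, c_∞}`, `τ = c_∞ ∉ Γ_K`.
[cite: SerreGaloisCohomology1997, I §2.4] [cite: NeukirchSchmidtWingberg2008, I §5 Prop. 1.5.6] -/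
theorem corH1_mem_resKer_of_involution (hN : IsOpen (N : Set G)) (hM : ∀ m : M, Continuous fun g : G ↦ g • m)
    (hc : ∀ b : G, Xor (b * c⁻¹ ∈ N) (b ∈ N)) {τ : G} (hτN : τ ∉ N) (hτ : τ * τ = 1)
    (φ : H →ₜ* G) (ψ : M →+ M') (h : ∀ (x : H) (m : M), ψ (φ x • m) = x • ψ m)
    (hφ : ∀ x : H, φ x = 1 ∨ φ x = τ) (y : subgroupH1 N M) :
    corH1 hN hM hc y ∈ resKer φ ψ h := by
  obtain ⟨f, rfl⟩ := oneCocycleClass_surjective _ y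
  rw [corH1_oneCocycleClass, oneCocycleClass_mem_resKer_iff]
  set m : M := f.1 ⟨τ * c, mul_mem_of_not_mem hc hτN⟩
  refine ⟨ψ (-m), fun x ↦ ?_⟩
  have hx : x • ψ (-m) = ψ (φ x • (-m)) := (h x (-m)).symm
  rcases hφ x with h1 | h2
  · rw [corCocycle_apply, h1, corFun_apply_one, map_zero, hx, h1, one_smul, sub_self]
  · rw [corCocycle_apply, h2, corFun_apply_involution hc f hτN hτ, hx, h2, map_sub, smul_neg, map_neg, map_neg]
    abel

/-- **Subgroup form**: for a subgroup `D ≤ G` contained in `{1, τ}` (`τ ∉ N`, `τ² = 1`), every corestricted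
class restricts to `0` in `H¹(D, M)`: `cor(y) ∈ subgroupResKer M D`. [cite: SerreGaloisCohomology1997, I §2.4] -/
theorem corH1_mem_subgroupResKer_of_involution (hN : IsOpen (N : Set G))
    (hM : ∀ m : M, Continuous fun g : G ↦ g • m) (hc : ∀ b : G, Xor (b * c⁻¹ ∈ N) (b ∈ N))
    {τ : G} (hτN : τ ∉ N) (hτ : τ * τ = 1) (D : Subgroup G) (hD : ∀ d ∈ D, d = 1 ∨ d = τ)
    (y : subgroupH1 N M) : corH1 hN hM hc y ∈ subgroupResKer M D :=
  corH1_mem_resKer_of_involution hN hM hc hτN hτ (subgroupIncl D) (AddMonoidHom.id M) (fun _ _ ↦ rfl)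
    (fun d ↦ by simpa only [subgroupIncl_apply] using hD d d.2) y

/-- **Order-`≤ 2` form** (the shape of a real place): if `H` is a group of order `≤ 2` and the image of
`φ : H → G` meets `N` trivially, then every corestricted class lies in `resKer φ ψ`.  (Either `φ` is trivial, or
its non-trivial value `τ = φ(σ)` is an involution outside `N` and `φ(H) = {1, τ}`.)
[cite: SerreGaloisCohomology1997, I §2.4] -/
theorem corH1_mem_resKer_of_natCard_le_two [Finite H] (hH : Nat.card H ≤ 2) (hN : IsOpen (N : Set G))
    (hM : ∀ m : M, Continuous fun g : G ↦ g • m) (hc : ∀ b : G, Xor (b * c⁻¹ ∈ N) (b ∈ N))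
    (φ : H →ₜ* G) (ψ : M →+ M') (h : ∀ (x : H) (m : M), ψ (φ x • m) = x • ψ m)
    (hφN : ∀ x : H, φ x ∈ N → φ x = 1) (y : subgroupH1 N M) :
    corH1 hN hM hc y ∈ resKer φ ψ h := by
  by_cases hex : ∃ σ : H, φ σ ≠ 1
  swap
  · -- trivial image: the pulled-back cocycle is identically `0`
    have htriv : ∀ x : H, φ x = 1 := fun x ↦ not_not.mp fun hx ↦ hex ⟨x, hx⟩
    obtain ⟨f, rfl⟩ := oneCocycleClass_surjective _ y
    rw [corH1_oneCocycleClass, oneCocycleClass_mem_resKer_iff]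
    refine ⟨0, fun x ↦ ?_⟩
    rw [corCocycle_apply, htriv x, corFun_apply_one, map_zero, smul_zero, sub_self]
  · obtain ⟨σ, hσ⟩ := hex
    have hσ1 : σ ≠ 1 := fun h1 ↦ hσ (by rw [h1, map_one])
    have hτN : φ σ ∉ N := fun hmem ↦ hσ (hφN σ hmem)
    have hτ : φ σ * φ σ = 1 := by rw [← map_mul, mul_self_eq_one_of_natCard_le_two hH σ, map_one]
    refine corH1_mem_resKer_of_involution hN hM hc hτN hτ φ ψ h (fun x ↦ ?_) y
    by_cases hx : x = 1
    · exact Or.inl (by rw [hx, map_one])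
    · exact Or.inr (by rw [eq_of_ne_one_of_natCard_le_two hH hx hσ1])

end ResKer

/-! ## §3 Which classes are corestrictions: the norm criterion -/

/-- **`x ∈ im(cor) ↔ res x` is a norm**, when `res : H¹(G, M) → H¹(N, M)` is injective (e.g. `M^N = 0`; for
`M = E[2^M]`, `N = Γ_K`: `E(K)[2] = 0`, the habitat).  (`⇒`: `res (cor y) = y + c_* y`; `⇐`: if `res x = y + c_* y
= res (cor y)` then `x = cor y` by injectivity.) [cite: SerreGaloisCohomology1997, I §2.4] -/
theorem mem_range_corH1_iff_exists_norm (hN : IsOpen (N : Set G)) (hM : ∀ m : M, Continuous fun g : G ↦ g • m)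
    (hc : ∀ b : G, Xor (b * c⁻¹ ∈ N) (b ∈ N)) (hinj : Function.Injective (resSubgroupH1 N M))
    (x : discreteH1 G M) :
    x ∈ (corH1 hN hM hc).range ↔ ∃ y : subgroupH1 N M, resSubgroupH1 N M x = y + conjH1 N M c y := by
  constructor
  · rintro ⟨y, rfl⟩
    exact ⟨y, resSubgroupH1_corH1 hN hM hc y⟩
  · rintro ⟨y, hy⟩
    refine ⟨y, hinj ?_⟩
    rw [resSubgroupH1_corH1 hN hM hc y, hy]

/-- **The archimedean criterion, norm form**: if `res` is injective and `res x` is a norm `y + c_* y`, then `x`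
dies along every compatible pair with image in `{1, τ}`, `τ ∉ N` an involution — for `x = d(n)` the `ℚ`-descended
Kolyvagin class this says: `c(n)` a norm from `H¹(K, E[2^M])` ⟹ `d(n)` vanishes identically at the real place
(in particular satisfies McCallum's Lemma 4.3 there), on either sign of `Δ`.
[cite: McCallumLMS1991, §4 Lemma 4.3] [cite: SerreGaloisCohomology1997, I §2.4] -/
theorem mem_resKer_of_resSubgroupH1_eq_norm {H : Type u} [Group H] [TopologicalSpace H] [IsTopologicalGroup H]
    {M' : Type u} [AddCommGroup M'] [DistribMulAction H M'] [TopologicalSpace M'] [DiscreteTopology M']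
    (hN : IsOpen (N : Set G)) (hM : ∀ m : M, Continuous fun g : G ↦ g • m)
    (hc : ∀ b : G, Xor (b * c⁻¹ ∈ N) (b ∈ N)) (hinj : Function.Injective (resSubgroupH1 N M))
    {τ : G} (hτN : τ ∉ N) (hτ : τ * τ = 1)
    (φ : H →ₜ* G) (ψ : M →+ M') (h : ∀ (x : H) (m : M), ψ (φ x • m) = x • ψ m)
    (hφ : ∀ x : H, φ x = 1 ∨ φ x = τ)
    {x : discreteH1 G M} {y : subgroupH1 N M} (hxy : resSubgroupH1 N M x = y + conjH1 N M c y) :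
    x ∈ resKer φ ψ h := by
  obtain ⟨y', rfl⟩ := (mem_range_corH1_iff_exists_norm hN hM hc hinj x).mpr ⟨y, hxy⟩
  exact corH1_mem_resKer_of_involution hN hM hc hτN hτ φ ψ h hφ y'

end Summit.BirchSwinnertonDyer.BirchSwinnertonDyer.Theorems.OffBigImageOddLocalAtTwo.ArchCorestriction

end
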